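import Summits.ValiantsHypothesis.ValiantsHypothesis.Theorems.KPlusLogSqLawTropicalBComparabilityChain
import Summits.ValiantsHypothesis.ValiantsHypothesis.Theorems.KPlusLogSqLawTropicalBComparabilityLinear

/-!
# `TropicalB` (stmt-ValiantsHypothesis-19771) — the NESTED LINEAR LAW for three-register comparability chains, part 1:
# the states of ONE middle row are linear (`≤ (3U+4)·L₂`)

Helper file for the crux `Theses.KPlusLogSqLaw.TropicalB` (`--supports stmt-ValiantsHypothesis-19771 --as helper`), cell
`pub-symmetroid`, seat val-sym-trop-p2 (g6; lineage question R25(a)/R33 of HOME/val-sym-trop-p2/g5/THREE-PIVOTS.md «three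
pivots: exponent 2 or 3?»).  HONEST FRAMING: a structure theorem about a SUB-FAMILY of the terms of an ARBITRARY design, in the
tree's vocabulary (`IsDominant`, `tropWeight`, `termSign`); hypotheses VERBATIM those of the THREE-LINK COMPARABILITY LAW
`ComparabilityChain.card_dominant_le_three` (val-sym-trop-p2 g5, p490014 / p490294).  It proves nothing about `TropicalB` in
its window and bears on neither `WeakLifting`, `MatrixDescartes` (stmt-ValiantsHypothesis-18050) nor VP ≠ VNP.

## Setting (g5's family, verbatim)
Terms `τ j y a b p u` (`j < N`; `y, a < L₁`; `b, p < L₂`; `u < U`) of a design `(d, v, ε)`, present and pairwise distinct whenever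
`y < a ∧ b < p`, with weights `θ·(s₁ j y + s₂ a b + s₃ p u) − (A j y + W a b + B p u)`: a first register `(j, y)`, a MIDDLE register
`(a, b)`, a third register `(p, u)`, coupled only through `y < a` and `b < p`.

## Statement (`card_rowStates_le`)
Fix a middle ROW `a`.  The row's own two-register system consists of the middle states `(a, b)` (ONE line per position `b`) and
the third register (`U` lines per position `p`), coupled by `b < p`.  THEN the states `(b, p, u)` of this system that occur in
SOME dominant member `τ j y a b p u` of the family (any first-register state `(j, y)` with `y < a`, any integer slope) number at
most `(3(1+U)+1)·L₂ = (3U+4)·L₂` — independently of `N`, `L₁` and of how often the row is revisited along the slope axis.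

## Proof
val-sym-trop-p5 g5's abstract count `ComparabilityLinear.card_le_of_adjacent_records` (p487275) instantiated on the row system:
choose for each occurring state a witnessing dominant member and its slope; distinct states have distinct slopes
(`eq_of_theta_eq`); along increasing slope, `b` is a strict prefix record of the row's middle lines and `p` a strict suffix
record of the third register with nothing of either kind strictly between (`r_lt_of_dominant`, `w_lt_of_dominant` — the
competitors `τ j y a b' p u`, `τ j y a b p' u'` are feasible members), each record predicate is interval-shaped in the slope
(`≤ 2` resp. `≤ 2U` flips per position), and along a fixed `p` the state `u` moves only to larger `s₃ p u`.
Part 2 (`…TropicalBComparabilityNestedLaw`) feeds this bound into trop-p5's LINEAR law once more, with the ROWS as a register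
whose states are these row states, and obtains the NESTED LINEAR LAW `≤ (3(N + (3U+4)L₂) + 1)·L₁` for the whole family.
[folklore-level: records of a kinetic tournament; all exchange steps are g5's `ComparabilityChain.weight_lt`]
-/

set_option linter.dupNamespace false
set_option autoImplicit false

namespace Summit.ValiantsHypothesis.ValiantsHypothesis.Theorems.KPlusLogSqLaw.ComparabilityChain

open Summit.ValiantsHypothesis.ValiantsHypothesis.Theorems.MatrixDescartes.Negative
open Summit.ValiantsHypothesis.ValiantsHypothesis.Theorems.KPlusLogSqLaw.ComparabilityLinear
  (card_le_of_adjacent_records card_flips_exists_le)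
open Finset

section Family

variable {m K N L₁ L₂ U : ℕ}
  (d : Fin K → ℕ) (v ε : Fin m → Fin m → Fin K → ℤ)
  (τ : Fin N → Fin L₁ → Fin L₁ → Fin L₂ → Fin L₂ → Fin U → Equiv.Perm (Fin m) × (Fin m → Fin K))
  (s₁ : Fin N → Fin L₁ → ℤ) (s₂ : Fin L₁ → Fin L₂ → ℤ) (s₃ : Fin L₂ → Fin U → ℤ)
  (A : Fin N → Fin L₁ → ℤ) (W : Fin L₁ → Fin L₂ → ℤ) (B : Fin L₂ → Fin U → ℤ)
  (hinj : ∀ j y a b p u j' y' a' b' p' u', y < a → b < p → y' < a' → b' < p' →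
    τ j y a b p u = τ j' y' a' b' p' u' → j = j' ∧ y = y' ∧ a = a' ∧ b = b' ∧ p = p' ∧ u = u')
  (hpres : ∀ j y a b p u, y < a → b < p → termSign ε (τ j y a b p u) ≠ 0)
  (hw : ∀ j y a b p u (θ : ℤ), y < a → b < p →
    tropWeight d v θ (τ j y a b p u) = θ * (s₁ j y + s₂ a b + s₃ p u) - (A j y + W a b + B p u))

include hinj hpres hw in
/-- FIRST-register comparison: a dominant member beats every other first-register state at a position `y' < a`
(the competitor `τ j' y' a b p u` is a feasible member). -/
theorem u_lt_of_dominant {j j' : Fin N} {y y' a : Fin L₁} {b p : Fin L₂} {u : Fin U} {θ : ℤ}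
    (hya : y < a) (hbp : b < p) (hy'a : y' < a) (hdom : IsDominant d v ε θ (τ j y a b p u))
    (hne : ¬ (j = j' ∧ y = y')) :
    θ * s₁ j' y' - A j' y' < θ * s₁ j y - A j y := by
  have h := weight_lt d v ε τ s₁ s₂ s₃ A W B hinj hpres hw hya hbp hy'a hbp hdom (j' := j') (a' := a) (b' := b) (u' := u)
    (by rintro ⟨e1, e2, -, -, -, -⟩; exact hne ⟨e1, e2⟩)
  linarith

include hinj hpres hw in
/-- MIDDLE comparison inside a row: a dominant member beats every other middle state `(a, b')` of ITS OWN ROW with `b' < p`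
(the competitor `τ j y a b' p u` is a feasible member). -/
theorem r_lt_of_dominant {j : Fin N} {y a : Fin L₁} {b b' p : Fin L₂} {u : Fin U} {θ : ℤ}
    (hya : y < a) (hbp : b < p) (hb'p : b' < p) (hdom : IsDominant d v ε θ (τ j y a b p u)) (hne : b ≠ b') :
    θ * s₂ a b' - W a b' < θ * s₂ a b - W a b := by
  have h := weight_lt d v ε τ s₁ s₂ s₃ A W B hinj hpres hw hya hbp hya hb'p hdom (j' := j) (a' := a) (p' := p) (u' := u)
    (by rintro ⟨-, -, -, e, -, -⟩; exact hne e)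
  linarith

include hinj hpres hw in
/-- THIRD-register comparison: a dominant member beats every other third-register state at a position `p' > b`
(the competitor `τ j y a b p' u'` is a feasible member). -/
theorem w_lt_of_dominant {j : Fin N} {y a : Fin L₁} {b p p' : Fin L₂} {u u' : Fin U} {θ : ℤ}
    (hya : y < a) (hbp : b < p) (hbp' : b < p') (hdom : IsDominant d v ε θ (τ j y a b p u))
    (hne : ¬ (p = p' ∧ u = u')) :
    θ * s₃ p' u' - B p' u' < θ * s₃ p u - B p u := by
  have h := weight_lt d v ε τ s₁ s₂ s₃ A W B hinj hpres hw hya hbp hya hbp' hdom (j' := j) (a' := a) (b' := b) (u' := u')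
    (by rintro ⟨-, -, -, -, e5, e6⟩; exact hne ⟨e5, e6⟩)
  linarith

include hinj hpres hw in
/-- ROW comparison: a dominant member beats every other (middle, third)-state pair `((a', b'), (p', u'))` with `y < a'` and
`b' < p'` (the competitor `τ j y a' b' p' u'` is a feasible member) — the rows `a' > y` together with their own right systems
form ONE register against the first. -/
theorem rw_lt_of_dominant {j : Fin N} {y a a' : Fin L₁} {b b' p p' : Fin L₂} {u u' : Fin U} {θ : ℤ}
    (hya : y < a) (hbp : b < p) (hya' : y < a') (hbp' : b' < p') (hdom : IsDominant d v ε θ (τ j y a b p u))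
    (hne : ¬ (a = a' ∧ b = b' ∧ p = p' ∧ u = u')) :
    θ * (s₂ a' b' + s₃ p' u') - (W a' b' + B p' u') < θ * (s₂ a b + s₃ p u) - (W a b + B p u) := by
  have h := weight_lt d v ε τ s₁ s₂ s₃ A W B hinj hpres hw hya hbp hya' hbp' hdom (j' := j)
    (a' := a') (b' := b') (p' := p') (u' := u')
    (by rintro ⟨-, -, e3, e4, e5, e6⟩; exact hne ⟨e3, e4, e5, e6⟩)
  linarith

open scoped Classical in
include hinj hpres hw in
/-- **THE STATES OF ONE ROW ARE LINEAR.**  For a fixed middle row `a`, the states `(b, p, u)` (`b < p`) of the row's own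
two-register system — middle row `a` (one line `θ·s₂ a b − W a b` per position `b`) against the third register (`U` lines per
position `p`), coupled by `b < p` — that occur in SOME dominant member `τ j y a b p u` of the family (`y < a`, any `j`, any
integer slope) number at most `(3(1+U)+1)·L₂`.  (trop-p5 g5's `card_le_of_adjacent_records` on the row system.) -/
theorem card_rowStates_le (a : Fin L₁) :
    ((Finset.univ : Finset (Fin L₂ × Fin L₂ × Fin U)).filter (fun s => s.1 < s.2.1 ∧
        ∃ (j : Fin N) (y : Fin L₁) (θ : ℤ), y < a ∧ IsDominant d v ε θ (τ j y a s.1 s.2.1 s.2.2))).card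
      ≤ (3 * (1 + U) + 1) * L₂ := by
  classical
  set S := ((Finset.univ : Finset (Fin L₂ × Fin L₂ × Fin U)).filter (fun s => s.1 < s.2.1 ∧
        ∃ (j : Fin N) (y : Fin L₁) (θ : ℤ), y < a ∧ IsDominant d v ε θ (τ j y a s.1 s.2.1 s.2.2))) with hS
  have hmemS : ∀ s ∈ S, s.1 < s.2.1 ∧
      ∃ (j : Fin N) (y : Fin L₁) (θ : ℤ), y < a ∧ IsDominant d v ε θ (τ j y a s.1 s.2.1 s.2.2) :=
    fun s hs => (Finset.mem_filter.1 hs).2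
  have hex : ∀ s ∈ S, ∃ w : Fin N × Fin L₁ × ℤ, w.2.1 < a ∧ IsDominant d v ε w.2.2 (τ w.1 w.2.1 a s.1 s.2.1 s.2.2) := by
    intro s hs
    obtain ⟨j, y, θ, hya, hdom⟩ := (hmemS s hs).2
    exact ⟨(j, y, θ), hya, hdom⟩
  -- (the witness type is inhabited as soon as `S` is)
  rcases S.eq_empty_or_nonempty with hSe | ⟨s₀, hs₀⟩
  · rw [hSe, Finset.card_empty]; exact Nat.zero_le _
  obtain ⟨j₀, y₀, -⟩ := (hmemS s₀ hs₀).2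
  haveI : Nonempty (Fin N × Fin L₁ × ℤ) := ⟨(j₀, y₀, 0)⟩
  choose! wit hwit using hex
  -- the witnessing slope of a state
  let Θ : Fin L₂ × Fin L₂ × Fin U → ℤ := fun s => (wit s).2.2
  -- distinct states are witnessed at distinct slopes
  have hΘinj : Set.InjOn Θ ↑S := by
    intro s hs s' hs' he
    have hs₁ := Finset.mem_coe.1 hs
    have hs₂ := Finset.mem_coe.1 hs'
    obtain ⟨hya, h1⟩ := hwit s hs₁
    obtain ⟨hya', h2⟩ := hwit s' hs₂
    have he' : (wit s).2.2 = (wit s').2.2 := he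
    rw [he'] at h1
    obtain ⟨-, -, -, e4, e5, e6⟩ :=
      eq_of_theta_eq d v ε τ s₁ s₂ s₃ A W B hinj hpres hw hya (hmemS s hs₁).1 hya' (hmemS s' hs₂).1 h1 h2
    exact Prod.ext e4 (Prod.ext e5 e6)
  rcases Nat.eq_zero_or_pos S.card with h0 | hpos
  · rw [h0]; exact Nat.zero_le _
  obtain ⟨i₀, hi₀⟩ := Finset.card_pos.1 hpos
  -- enumerate the states by increasing witnessing slope
  set n := S.card with hn
  have hT : (S.image Θ).card = n := Finset.card_image_of_injOn hΘinj
  let e : Fin n ↪o ℤ := (S.image Θ).orderEmbOfFin hT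
  have hmemT : ∀ k : Fin n, ∃ s ∈ S, Θ s = e k := fun k => by
    have h := Finset.orderEmbOfFin_mem (S.image Θ) hT k
    simpa only [Finset.mem_image] using h
  choose member hmem hΘmem using hmemT
  let mem' : ℕ → Fin L₂ × Fin L₂ × Fin U := fun k => if h : k < n then member ⟨k, h⟩ else i₀
  have hmem'S : ∀ k, k < n → mem' k ∈ S := by
    intro k hk; simp only [mem', dif_pos hk]; exact hmem _
  have hmem'Θ : ∀ k (hk : k < n), Θ (mem' k) = e ⟨k, hk⟩ := by
    intro k hk; simp only [mem', dif_pos hk]; exact hΘmem _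
  let t : ℕ → ℤ := fun k => Θ (mem' k)
  have ht : ∀ k k', k < k' → k' < n → t k < t k' := by
    intro k k' hkk' hk'
    show Θ (mem' k) < Θ (mem' k')
    rw [hmem'Θ k (hkk'.trans hk'), hmem'Θ k' hk']
    exact e.strictMono (Fin.mk_lt_mk.2 hkk')
  have hmem'inj : ∀ k k', k < n → k' < n → mem' k = mem' k' → k = k' := by
    intro k k' hk hk' heq
    have h1 : e ⟨k, hk⟩ = e ⟨k', hk'⟩ := by rw [← hmem'Θ k hk, ← hmem'Θ k' hk', heq]
    have h2 := e.injective h1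
    simpa using h2
  -- the member data: positions `b`, `p`, states `0 : Fin 1` and `u`, witnesses `j`, `y`
  let jj : ℕ → Fin 1 := fun _ => ⟨0, Nat.one_pos⟩
  let bb : ℕ → Fin L₂ := fun k => (mem' k).1
  let pp : ℕ → Fin L₂ := fun k => (mem' k).2.1
  let uu : ℕ → Fin U := fun k => (mem' k).2.2
  let jw : ℕ → Fin N := fun k => (wit (mem' k)).1
  let yw : ℕ → Fin L₁ := fun k => (wit (mem' k)).2.1
  have hbp : ∀ k, k < n → bb k < pp k := fun k hk => (hmemS _ (hmem'S k hk)).1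
  have hya : ∀ k, k < n → yw k < a := fun k hk => (hwit _ (hmem'S k hk)).1
  have hdom : ∀ k, k < n → IsDominant d v ε (t k) (τ (jw k) (yw k) a (bb k) (pp k) (uu k)) :=
    fun k hk => (hwit _ (hmem'S k hk)).2
  -- the record predicates of the ROW system and their configurations
  let RA : Fin L₂ → Fin 1 → ℕ → Prop := fun z _ k =>
    ∀ b' : Fin L₂, b' < z → t k * s₂ a b' - W a b' < t k * s₂ a z - W a z
  let RB : Fin L₂ → Fin U → ℕ → Prop := fun z u₀ k =>
    ∀ (u' : Fin U) (p' : Fin L₂), z < p' → t k * s₃ p' u' - B p' u' < t k * s₃ z u₀ - B z u₀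
  let Ar : ℕ → Finset (Fin L₂) := fun k => (Finset.univ : Finset (Fin L₂)).filter (fun z => ∃ j₀, RA z j₀ k)
  let Br : ℕ → Finset (Fin L₂) := fun k => (Finset.univ : Finset (Fin L₂)).filter (fun z => ∃ u₀, RB z u₀ k)
  have hmemAr : ∀ k z, z ∈ Ar k ↔ ∃ j₀, RA z j₀ k := fun k z => by
    simp only [Ar, Finset.mem_filter, Finset.mem_univ, true_and]
  have hmemBr : ∀ k z, z ∈ Br k ↔ ∃ u₀, RB z u₀ k := fun k z => by
    simp only [Br, Finset.mem_filter, Finset.mem_univ, true_and]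
  -- (1) adjacency
  have hadj : ∀ k, k < n → bb k ∈ Ar k ∧ pp k ∈ Br k ∧ bb k < pp k ∧
      ∀ z : Fin L₂, bb k < z → z < pp k → z ∉ Ar k ∧ z ∉ Br k := by
    intro k hk
    have hD := hdom k hk
    have hbp₀ := hbp k hk
    have hya₀ := hya k hk
    refine ⟨(hmemAr k _).2 ⟨jj k, fun b' hb' => ?_⟩, (hmemBr k _).2 ⟨uu k, fun u' p' hp' => ?_⟩, hbp₀,
      fun z hbz hzp => ⟨fun h => ?_, fun h => ?_⟩⟩
    · exact r_lt_of_dominant d v ε τ s₁ s₂ s₃ A W B hinj hpres hw hya₀ hbp₀ (hb'.trans hbp₀) hD (ne_of_gt hb')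
    · exact w_lt_of_dominant d v ε τ s₁ s₂ s₃ A W B hinj hpres hw hya₀ hbp₀ (hbp₀.trans hp') hD
        (by rintro ⟨e, -⟩; exact absurd e (ne_of_lt hp'))
    · obtain ⟨j₀, hz⟩ := (hmemAr k z).1 h
      have h1 := hz (bb k) hbz
      have h2 := r_lt_of_dominant d v ε τ s₁ s₂ s₃ A W B hinj hpres hw hya₀ hbp₀ hzp hD (ne_of_lt hbz)
      linarith
    · obtain ⟨u₀, hz⟩ := (hmemBr k z).1 h
      have h1 := hz (uu k) (pp k) hzp
      have h2 := w_lt_of_dominant d v ε τ s₁ s₂ s₃ A W B hinj hpres hw hya₀ hbp₀ hbz hD (u' := u₀)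
        (by rintro ⟨e, -⟩; exact absurd e (ne_of_gt hzp))
      linarith
  -- (2) distinctness
  have hinj' : ∀ k k', k < n → k' < n → jj k = jj k' → bb k = bb k' → pp k = pp k' → uu k = uu k' → k = k' := by
    intro k k' hk hk' _ e2 e3 e4
    exact hmem'inj k k' hk hk' (Prod.ext e2 (Prod.ext e3 e4))
  -- (3) few flips: each record predicate is interval-shaped in the slope
  have hRA : ∀ z j₀, ∀ a₁ b₁ c₁ : ℕ, a₁ < b₁ → b₁ < c₁ → c₁ < n → RA z j₀ a₁ → RA z j₀ c₁ → RA z j₀ b₁ := by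
    intro z j₀ a₁ b₁ c₁ hab hbc hc ha hc' b' hb'
    have h1 := ha b' hb'
    have h2 := hc' b' hb'
    have t1 := ht a₁ b₁ hab (hbc.trans hc)
    have t2 := ht b₁ c₁ hbc hc
    rcases le_or_gt (s₂ a b' - s₂ a z) 0 with hs | hs
    · nlinarith
    · nlinarith
  have hRB : ∀ z u₀, ∀ a₁ b₁ c₁ : ℕ, a₁ < b₁ → b₁ < c₁ → c₁ < n → RB z u₀ a₁ → RB z u₀ c₁ → RB z u₀ b₁ := by
    intro z u₀ a₁ b₁ c₁ hab hbc hc ha hc' u' p' hp'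
    have h1 := ha u' p' hp'
    have h2 := hc' u' p' hp'
    have t1 := ht a₁ b₁ hab (hbc.trans hc)
    have t2 := ht b₁ c₁ hbc hc
    rcases le_or_gt (s₃ p' u' - s₃ z u₀) 0 with hs | hs
    · nlinarith
    · nlinarith
  have hflipA : ∀ z : Fin L₂,
      ((Finset.range n).filter (fun k => k + 1 < n ∧ ¬ (z ∈ Ar k ↔ z ∈ Ar (k + 1)))).card ≤ 2 * 1 := by
    intro z
    refine le_trans (Finset.card_le_card ?_) (card_flips_exists_le n 1 (fun j₀ k => RA z j₀ k) (hRA z))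
    intro k hk
    simp only [Finset.mem_filter] at hk ⊢
    rw [hmemAr, hmemAr] at hk
    exact hk
  have hflipB : ∀ z : Fin L₂,
      ((Finset.range n).filter (fun k => k + 1 < n ∧ ¬ (z ∈ Br k ↔ z ∈ Br (k + 1)))).card ≤ 2 * U := by
    intro z
    refine le_trans (Finset.card_le_card ?_) (card_flips_exists_le n U (fun u₀ k => RB z u₀ k) (hRB z))
    intro k hk
    simp only [Finset.mem_filter] at hk ⊢
    rw [hmemBr, hmemBr] at hk
    exact hk
  -- (4) state monotonicity along a fixed position (vacuous for the one-state middle row)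
  let σ₁' : Fin 1 → Fin L₂ → ℤ := fun _ z => s₂ a z
  have hmono₁ : ∀ k k', k < k' → k' < n → bb k = bb k' → jj k ≠ jj k' →
      σ₁' (jj k) (bb k) < σ₁' (jj k') (bb k) := by
    intro k k' _ _ _ hjj
    exact absurd rfl hjj
  have hmono₂ : ∀ k k', k < k' → k' < n → pp k = pp k' → uu k ≠ uu k' → s₃ (pp k) (uu k) < s₃ (pp k) (uu k') := by
    intro k k' hkk' hk' hpp huu
    have hk : k < n := hkk'.trans hk'
    have h1 := w_lt_of_dominant d v ε τ s₁ s₂ s₃ A W B hinj hpres hw (hya k hk) (hbp k hk) (hbp k hk) (hdom k hk)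
      (u' := uu k') (by rintro ⟨-, e⟩; exact huu e)
    have h2 := w_lt_of_dominant d v ε τ s₁ s₂ s₃ A W B hinj hpres hw (hya k' hk') (hbp k' hk') (hbp k' hk') (hdom k' hk')
      (u' := uu k) (by rintro ⟨-, e⟩; exact huu e.symm)
    rw [← hpp] at h2
    have t1 := ht k k' hkk' hk'
    nlinarith
  exact card_le_of_adjacent_records n Ar Br bb pp jj uu σ₁' s₃ hadj hinj' hflipA hflipB hmono₁ hmono₂

end Family

end Summit.ValiantsHypothesis.ValiantsHypothesis.Theorems.KPlusLogSqLaw.ComparabilityChain
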